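import Summits.BirchSwinnertonDyer.BirchSwinnertonDyer.Theorems.GenusKolyvaginAtTwoPowDvdShaCardAtTwoRTHalfTransverseOfValues
import Summits.BirchSwinnertonDyer.BirchSwinnertonDyer.Theorems.GenusKolyvaginAtTwoPowDvdShaCardAtTwoRTTransverseIsotropicRegular
import HarnessLib

/-!
# Route `GenusKolyvaginAtTwo`, crux L_T (stmt-BirchSwinnertonDyer-23242) / L⁺_T `PowDvdShaCardAtTwoPosT` (stmt-23379), LINE 18/19,
# bottom rung at a REGULAR Kolyvagin prime: the (iii)-SOCKET with `hFμ` discharged by regularity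

Seat `bsd-line-gk2-p3` g21 (PROVER seat 3/3, cell `bsd-f1-sign2`), `--supports 23242 --as helper` (serves LINE 19's 23379 verbatim).
THEOREMS ONLY; no `sorry`.  BSD is NOT proved by any of this; neither crux is.

WHY.  The (iii)-socket `halfTransverse_of_resTorsion_values(_of_eq_mul_inertia)` (`…RTHalfTransverseOfValues`, p704347/p704962) uses the
tame anti-invariance `smul_h1Eval_eq_neg_of_mem_inertia`, which needs `F` to invert `μ_q` (`hFμ`).  On `Δ < 0` that comes from
`FrobEqFrobInfty`; at the REGULAR primes of LINE 19 (`Δ > 0`, `RegularKolyvaginSupplyAtTwo`) it FOLLOWS from regularity through a Weil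
pairing (`smul_eq_inv_of_regular`, p693866) — exactly as `…RTTransverseIsotropicRegular` / `…RTHalfTransverseIsotropicRegular` did for I7 / I7½.
* **`halfTransverse_of_resTorsion_values_of_regular`** — the socket at a regular Frobenius (Weil-pairing data `e` instead of `hFμ`), in the
  robust form `res g₂ = F²·i`, `i` inertial.
HONEST FRAMING: one-line corollary; closes nothing.  BSD is NOT proved by any of this.

References: [McCallumLMS1991] §4 Prop. 4.4 (1), §5 Lemma 5.3; [GrossLMS1991] §3 (3.3).
-/

set_option autoImplicit false
set_option linter.dupNamespace false -- tree convention: `Summit.BirchSwinnertonDyer.BirchSwinnertonDyer.Theorems` (summit = sub-problem)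

noncomputable section
open scoped Classical Pointwise

namespace Summit.BirchSwinnertonDyer.BirchSwinnertonDyer.Theorems.GenusExact.TransverseIsotropy

open WeierstrassCurve NumberField IsDedekindDomain Field
open Literature.NumberTheory.EllipticCurves Literature.NumberTheory.GaloisRepresentations
open Literature.NumberTheory.GaloisCohomology

variable {v : HeightOneSpectrum (𝓞 ℚ)} (W : WeierstrassCurve ℚ) [W.IsElliptic] (K : Type) [Field K] [NumberField K]

/-- **(iii)-SOCKET at a REGULAR Frobenius** (`hFμ` discharged): setting of `halfTransverse_of_resTorsion_values_of_eq_mul_inertia` with, instead of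
`hFμ`, an alternating non-degenerate `Γ_ℚ`-equivariant `μ_q`-valued pairing `e` on `E[q]` (a Weil pairing); `F` a regular involution on `E[q]`
inverts `μ_q` by `smul_eq_inv_of_regular`.  Conclusion: `x` is half-transverse at `F`.  Applies at the `RegularKolyvaginSupplyAtTwo` primes of
LINE 19. [cite: McCallumLMS1991, §4 Prop. 4.4 (1) and §5 Lemma 5.3] -/
theorem halfTransverse_of_resTorsion_values_of_regular {M q : ℕ} [NeZero q] (hM : 2 ≤ M) (hq : q = 2 ^ M)
    (hqv : (q : 𝓞 ℚ) ∉ v.asIdeal)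
    {𝔐 : Ideal (HeightOneSpectrum.localAbsIntegers v)} (h𝔐 : 𝔐 ∈ v.localPrimesAbove)
    {F : absoluteGaloisGroup ℚ}
    (hFrob : IsArithFrobAt (𝓞 ℚ) F (v.primeBelow (closureEmb (K := ℚ) (v.adicCompletion ℚ)) 𝔐))
    (hF : ∀ Q : geomTorsion W (q : ℤ), F • F • Q = Q)
    {P : geomTorsion W (q : ℤ)} (hPM : (2 : ℤ) ^ M • P = 0)
    (hgen : ∀ Q : geomTorsion W (q : ℤ), ∃ x y : ℤ, Q = x • P + y • F • P)
    (hfreeq : ∀ x y : ℤ, x • P + y • F • P = 0 → (q : ℤ) ∣ x ∧ (q : ℤ) ∣ y)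
    (hfree : ∀ x y : ℤ, x • P + y • F • P = 0 → (2 : ℤ) ^ M ∣ x ∧ (2 : ℤ) ^ M ∣ y)
    (hI : (v.primeBelow (closureEmb (K := ℚ) (v.adicCompletion ℚ)) 𝔐).inertia (absoluteGaloisGroup ℚ) ≤
      torsionFixing W (q : ℤ))
    (e : geomTorsion W q → geomTorsion W q → AlgebraicClosure ℚ)
    (hμ : ∀ S T, e S T ^ q = 1) (hadd₁ : ∀ S₁ S₂ T, e (S₁ + S₂) T = e S₁ T * e S₂ T)
    (hadd₂ : ∀ S T₁ T₂, e S (T₁ + T₂) = e S T₁ * e S T₂) (halt : ∀ T, e T T = 1)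
    (hnondeg : ∀ T, (∀ S, e S T = 1) → T = 0)
    (hgal : ∀ (σ : absoluteGaloisGroup ℚ) (S T : geomTorsion W q), σ • e S T = e (σ • S) (σ • T))
    {x : galH1Torsion W (q : ℤ)} {g₂ σ₁ : absoluteGaloisGroup K}
    (hg₂ : g₂ ∈ torsionFixing (W.baseChange K) (q : ℤ)) (hσ₁ : σ₁ ∈ torsionFixing (W.baseChange K) (q : ℤ))
    {i : absoluteGaloisGroup ℚ}
    (hi : i ∈ (v.primeBelow (closureEmb (K := ℚ) (v.adicCompletion ℚ)) 𝔐).inertia (absoluteGaloisGroup ℚ))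
    (hg₂F : resGal (K := ℚ) K g₂ = F * F * i)
    (hσ₁I : resGal (K := ℚ) K σ₁ ∈ (v.primeBelow (closureEmb (K := ℚ) (v.adicCompletion ℚ)) 𝔐).inertia (absoluteGaloisGroup ℚ))
    (hval : ∃ k : ℤ, h1Eval (W.baseChange K) (q : ℤ) (resTorsion W K (q : ℤ) x) g₂ =
      k • h1Eval (W.baseChange K) (q : ℤ) (resTorsion W K (q : ℤ) x) σ₁) :
    ∃ P₁ Q₁ : geomTorsion W (q : ℤ), h1Eval W (q : ℤ) x F = (F • P₁ - P₁) + (2 : ℕ) • Q₁ :=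
  halfTransverse_of_resTorsion_values_of_eq_mul_inertia W K hM hq hqv h𝔐 hFrob
    (fun _ hζ ↦ smul_eq_inv_of_regular W e hμ hadd₁ hadd₂ halt hnondeg hgal hF hgen hfreeq hζ)
    hF hPM hgen hfree hI hg₂ hσ₁ hi hg₂F hσ₁I hval

end Summit.BirchSwinnertonDyer.BirchSwinnertonDyer.Theorems.GenusExact.TransverseIsotropy

end
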